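import Literature.IUT.HodgeTheaters.StableCurveTemperedDataOfSpecialFibreCuspedPiDataNVExposed
import Literature.IUT.HodgeTheaters.StableCurveTemperedDataOfSpecialFibreLevelQuotientRFDescent
import Literature.IUT.HodgeTheaters.StableCurveTemperedDataOfSpecialFibreProp24Compact
import HarnessLib

/-!
# The §2 ONE-CALL is JOINTLY NON-VACUOUS: [IUTchI] Prop. 2.4 (i)(ii)(iii) ∧ Cor. 2.5 AS TYPED, obtained by CALLING
# `prop24_cor25_ofPiData_byName_noRF` at the cusped free-profinite `PiData` witness ([IUTchI] pp. 50–51)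

S. Mochizuki, *Inter-universal Teichmüller theory I*, kurims manuscript (May 2020), §2, Prop. 2.4 (i)(ii)(iii)
pp. 50–51, Cor. 2.5 p. 51 [cite: Mochizuki2012, Prop 2.4 pp.50-51] (D-0012 claim key; nothing of the series is
asserted here); S. Mochizuki, *Semi-graphs of anabelioids*, Publ. RIMS **42** (2006), Ex. 3.10 p. 44, Thm. 5.4 p. 66,
§6 p. 71 [cite: MochizukiSemiAnbd2006, Ex 3.10 p.44]; Y. Hoshi, S. Mochizuki, [NodNon] Lem. 1.9 (ii) p. 291.

PROOF-ONLY non-vacuity file (abc-iut cell, L5 [IUTchI] §2 lineage, row «SEC2-ONECALL-(ii)-SIDE-NV» part (F2); no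
definition, no instance, no notation, no new `Prop` fact).  The one-call of record
`StableCurveTemperedData.OfSpecialFibre.prop24_cor25_ofPiData_byName_noRF` (abc-iut-L5-t11 gen 8, p467772) concludes
`Prop24i ∧ Prop24ii ∧ Prop24iii` and `Cor25Decomposition ∧ Cor25Inertia` of the genuine 𝔛-datum
`ofSpecialFibre X d S …` from the origin records `(T, P : PiData X d S T)`, a cusp `x`, six LAWS
`hTF · hNN_i · hab · hadm · hI_j · hA3ar_j`, and per-level identification / decomposition DATA
(`G_i, σ_i, Λv, hvert, hΛv`, node data, `Dd_j`, arithmetic node data).  Here: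

* `prop24_cor25_ofPiData_byName_of_oneVertexFibres` — at ANY 𝔛-datum whose special-fibre tower has ONE-VERTEX
  fibres with `⊤ ≤ π₁^temp(𝒢_i)` verticial (abc-iut-L3-t3's (E1)/(E2), p472109) and COMPACT `Π^temp_{X_K}`, ALL the
  remaining one-call inputs are inhabited — `G_i` := the one-vertex `PSCDatum` on `Π̂_{𝔾_{J_i}}` with
  `Π_v := ι(π₁^temp(𝒢_i)) = Π̂` (the completion map of a compact group is onto), no node, no cusp, `Σ(G_i) :=` all
  primes; `σ_i` from `Unique`; `Λv := ⊤`; `hNN_i` ([NodNon] Lem. 1.9 (ii) shape, F-2540) by its first disjunct;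
  `Dd_j` := the one-vertex `DecompositionData` on `Π^tp_X/admKer_j` with `Π^temp_{𝔊,v} := ⊤`, so that `hI_j`
  ([SemiAnbd] Thm. 5.4 (i) shape) holds because the only verticial subgroup is `⊤`, and `hA3ar_j` by its first
  disjunct because `ι_j : Π^tp_X/admKer_j → Π̂_X/cl(admKer_j)` is onto (again by compactness) — so the one-call FIRES
  from `hTF · hab · hadm` alone;
* `sec2_oneCall_nonvacuous` — **the HEADLINE, binder-free**: for every prime `p` there EXIST `X d S T`, a `PiData`,
  a cusp and a prime set `Σ ∌ p` such that the conclusion of the one-call HOLDS at `ofSpecialFibre X d S …` — by the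
  call above at abc-iut-f-193's cusped free-profinite witness re-exported with exposed fibres
  (`exists_piData_cusp_torsionFreeAb_ab_adm_exposed`, part (F1)).

WHAT IS NEW AND WHAT IS NOT.  That the CONCLUSION (Prop. 2.4 (i)(ii)(iii), Cor. 2.5 AS TYPED) holds at every
𝔛-datum with compact `Π^temp_{X_K}` is already in the tree and content-free there (abc-iut-f-193's
`prop24i/ii/iii_ofSpecialFibre_of_compactSpace`, `cor25_ofSpecialFibre_of_compactSpace`, p440842: "at compact `Π^temp`
tempered = profinite").  What this file adds is the NON-VACUITY OF THE ONE-CALL'S HYPOTHESIS SET: its six laws and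
all its identification / decomposition data are JOINTLY inhabited at one datum, and the call ELABORATES there — the
evidence the CERT-L5 §2 NV column cites (abc-iut-L5-lead RULINGS #99 (5) / #101 (1)).

GLOBAL TAG: «[degenerate; single-vertex levels; ⊤ verticial; COMPACT Π^temp (the model's tempered group is profinite);
(D3)]» — inhabited ≠ discharged.

HONEST TAGS, PER HYPOTHESIS of `prop24_cor25_ofPiData_byName_of_oneVertexFibres` / of the one-call (abc-iut-L5-t11
gen 8 (D3)): HOW the degenerate tower meets each.  DEGENERATE WITNESS — one-vertex
special fibres, no nodes, no branches, profinite `Δ = F̂₂` with trivial graph actions, `Π^temp = G_{ℚ_p} × F̂₂` a compact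
direct product (so `Π^temp = Π̂` and every level quotient embedding `ι_j` is onto), admissible kernels `admKer_i = 1`:
* `hTF` ([Config] Rmk 1.2.2 shape) — GENUINE-SHAPE: open subgroups of the free profinite `F̂₂ ≅ Δ̂_X` have torsion-free
  abelianization (abc-iut-w4-d055), a real theorem about the witness group;
* `hab` (pro-`Σ` abelianization law) — DEGENERATE: `Ker(adm_i) = 1 ≤` anything; `hadm` (admissible kernels shrink to
  `1`) — DEGENERATE: `admKer_0 = 1`;
* `hNN_i` ([NodNon] Lem. 1.9 (ii) shape, F-2540) — DEGENERATE: first disjunct, the unique vertex with `Π_v = ι(⊤) = Π̂`,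
  the node disjunct never exercised (no nodes); the identification data `σ_i, Λv := ⊤, hvert, hΛv` are the (E1)/(E2)
  structure of the witness, the node data `src, tgt, c₁, c₂, hends, h₁, h₂, hloop` are VACUOUS (empty node type);
* `hI_j` ([SemiAnbd] Thm. 5.4 (i) shape) — DEGENERATE: with `Π^temp_{𝔊,v} := ⊤` the only verticial subgroup is `⊤`, so
  clause 1 is trivial and the two-verticial clause VACUOUS; the arithmetic node data `srcA, tgtA, c₁A, c₂A` VACUOUS;
* `hA3ar_j` ([AbsTopII] 1.3 (iv) / (A3-arith) shape) — DEGENERATE: first disjunct, because `ι_j(⊤) = ⊤`.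
abc-iut-L3-t2's HONEST LIMITS carried (not the tower of a curve, not André's `π₁^temp`).  A model inhabits OUR binders
only — it says the §2 one-call's hypotheses are JOINTLY SATISFIABLE and that the call elaborates at a datum, nothing
about the curves of [IUTchI] §2.  Nothing here bears on [IUTchIII] Cor. 3.12; typed ≠ inhabited ≠ discharged.
-/

noncomputable section

namespace Literature.IUT.HodgeTheaters

open _root_.Topology
open scoped Pointwise
open Literature.AnabelianGeometry.SemiGraphs Literature.AnabelianGeometry.SemiGraphs.ProfiniteSemiGraph

/-! ### A. Group-theoretic bookkeeping -/

/-- A conjugate of `⊤` is `⊤`. [cite: MochizukiSemiAnbd2006, §0 p.5] -/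
private theorem conjSubgroup_top {G : Type*} [Group G] (g : G) : conjSubgroup g (⊤ : Subgroup G) = ⊤ := by
  rw [conjSubgroup, ← MonoidHom.range_eq_map]
  exact MonoidHom.range_eq_top.mpr (MulAut.conj g).surjective

namespace StableCurveTemperedData

namespace OfSpecialFibre

variable {p : ℕ} [Fact p.Prime] (X : TemperedCurve p)

/-! ### B. Compactness bookkeeping at a datum with compact `Π^temp_{X_K}` (onto-ness of the `ι`'s BY NAME:
abc-iut-w6-d055's `TemperedCurve.toHat_surjective_of_compactSpace`, abc-iut-f-193's
`surjective_of_isProfiniteCompletion_of_compactSpace` / `TemperedGraphGroupData.ofChart_ι_surjective_of_compactSpace`,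
p440842) -/

/-- If `Π^temp_{X_K}` is compact, every LEVEL chart group `π₁^temp(𝒢_i)` of a special-fibre tower over `Δ^temp_X` is
compact (image of the open, hence closed, level `N_i ≤ Δ^temp_X = Ker(aug)` under the admissible surjection; the
base-chart analogue is abc-iut-f-193's `compactSpace_chart_of_compactSpace`). [cite: MochizukiSemiAnbd2006, Ex 3.10 p.44] -/
theorem compactSpace_levelChart_of_compactSpace (T : SpecialFibreTower X.DeltaTemp) [CompactSpace X.PiTemp]
    (i : ℕ) : CompactSpace (T.chart i).G := by
  haveI : CompactSpace X.DeltaTemp := isCompact_iff_compactSpace.mp X.isClosed_deltaTemp.isCompact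
  haveI : CompactSpace (T.N i) :=
    isCompact_iff_compactSpace.mp (Subgroup.isClosed_of_isOpen _ (T.isOpen_N i)).isCompact
  rw [← isCompact_univ_iff, ← Set.range_eq_univ.mpr (T.adm_surjective i)]
  exact isCompact_range (T.adm i).continuous

variable (T : SpecialFibreTower X.DeltaTemp) (Sigma SigmaHat : Set ℕ) (hsub : Sigma ⊆ SigmaHat)
  (hne : Set.Nonempty Sigma) (hprime : ∀ q ∈ SigmaHat, q.Prime)

/-- If `Π^temp_{X_K}` is compact, the completion map `π₁^temp(𝒢_i) → Π̂_{𝔾_{J_i}}` of every level graph is onto: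
`ι(⊤) = ⊤`. [cite: MochizukiSemiAnbd2006, Ex 3.10 p.44] -/
theorem levelGraph_map_top_eq_top [CompactSpace X.PiTemp] (i : ℕ) :
    (⊤ : Subgroup (T.chart i).G).map (levelGraph X T Sigma SigmaHat hsub hne hprime i).ι = ⊤ := by
  haveI := compactSpace_levelChart_of_compactSpace X T i
  have hsurj : Function.Surjective (levelGraph X T Sigma SigmaHat hsub hne hprime i).ι :=
    TemperedGraphGroupData.ofChart_ι_surjective_of_compactSpace (T.Gc i) (T.hyp i).toProp36Hypotheses (T.chart i)
      Sigma SigmaHat hsub hne hprime ⊤ ⊤ le_top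
  refine eq_top_iff.mpr fun y _ => ?_
  obtain ⟨t, rfl⟩ := hsurj y
  exact ⟨t, Subgroup.mem_top _, rfl⟩

variable (d : X.GroupLevelData) (S : SpecialFibreData (X.toTemperedArithmeticGroup d))
  (h36 : S.Gc.Prop36Hypotheses) (hp : p ∉ Sigma) (TpH : Subgroup S.chart.G)
  (HatH : Subgroup (TemperedGraphGroupData.exists_completion_of_prop36 S.Gc h36 S.chart).choose)
  (hle : TpH.map (TemperedGraphGroupData.exists_completion_of_prop36 S.Gc h36
    S.chart).choose_spec.choose.toMonoidHom ≤ HatH)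
  (cuspMeetsH : {x : X.Pt // X.IsCusp x} → Prop)

/-- If `Π^temp_{X_K}` is compact, the level-quotient embedding `ι_j : Π^tp_X/admKer_j → Π̂_X/cl(admKer_j)` of the
quotient tower over `P` is onto: `ι_j(⊤) = ⊤`. ([IUTchI] Prop 2.4(ii) p.51) [claim: Mochizuki2012, status: disputed] -/
theorem qTower_map_top_eq_top (P : SpecialFibreTower.PiData X d S T) [CompactSpace X.PiTemp] (j : ℕ) :
    (⊤ : Subgroup ((qTowerOfSpecialFibreTower X T d S h36 Sigma SigmaHat hsub hne hprime hp TpH HatH hle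
        cuspMeetsH P.admKer_normal_pi).Q j).Tp).map
      ((qTowerOfSpecialFibreTower X T d S h36 Sigma SigmaHat hsub hne hprime hp TpH HatH hle
        cuspMeetsH P.admKer_normal_pi).Q j).ι = ⊤ := by
  haveI : (admKerPi X T j).Normal := P.admKer_normal_pi j
  haveI : (admKerHat X T j).Normal := admKerHat_normal X T j (P.admKer_normal_pi j)
  have hsurj : Function.Surjective
      (QuotientGroup.map (admKerPi X T j) (admKerHat X T j) X.toHat.toMonoidHom
        (admKerPi_le_comap_admKerHat X T j)) := by
    intro y
    induction y using QuotientGroup.induction_on with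
    | H z =>
      obtain ⟨t, rfl⟩ := X.toHat_surjective_of_compactSpace z
      exact ⟨QuotientGroup.mk t, rfl⟩
  refine eq_top_iff.mpr fun y _ => ?_
  obtain ⟨t, rfl⟩ := hsurj y
  exact ⟨t, Subgroup.mem_top _, rfl⟩

/-! ### C. The one-call FIRES at a datum with one-vertex fibres and compact `Π^temp_{X_K}` -/

/-- **[IUTchI] Prop. 2.4 (i)(ii)(iii) ∧ Cor. 2.5 AS TYPED at a 𝔛-datum whose tower has ONE-VERTEX fibres with `⊤`
verticial and COMPACT `Π^temp_{X_K}`, from `hTF · hab · hadm` ALONE** — by CALLING the one-call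
`prop24_cor25_ofPiData_byName_noRF` (p467772) with its remaining inputs inhabited DEGENERATELY: `G_i` the one-vertex
`PSCDatum` on `Π̂_{𝔾_{J_i}}` (`Π_v := ι(⊤) = ⊤`, no node, no cusp, `Σ(G_i)` := all primes), `σ_i` from `Unique`,
`Λv := ⊤` (verticial by (E2)), `hNN_i` / `hA3ar_j` by their first disjuncts (`ι(⊤) = ⊤`), `Dd_j` one-vertex with
`Π^temp_{𝔊,v} := ⊤` so that `hI_j` holds (the only verticial subgroup is `⊤`), empty node data.  Degenerate:
documents that the typed one-call's (A3)/(ii)-side inputs impose nothing at such data.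
([IUTchI] Prop 2.4, Cor 2.5 pp.50-51) [claim: Mochizuki2012, status: disputed] -/
theorem prop24_cor25_ofPiData_byName_of_oneVertexFibres (P : SpecialFibreTower.PiData X d S T)
    (x : {x : X.Pt // X.IsCusp x}) [CompactSpace X.PiTemp]
    (hUV : ∀ i, Nonempty (Unique (T.Gc i).graph.Vertex))
    (htop : ∀ i v, (⊤ : Subgroup (T.chart i).G) ∈ verticialSubgroups (T.chart i) v)
    (hTF : ∀ H : Subgroup X.DeltaHat, IsOpen (H : Set X.DeltaHat) →
      ∀ (h : H) (n : ℕ), n ≠ 0 →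
        SigmaCharDetects Set.univ H h → SigmaCharDetects Set.univ H (h ^ n))
    (hab : ∀ (i : ℕ) (A : Type) [CommGroup A] [Finite A] (χ : T.N i →* A),
      IsOpen ((χ.ker : Subgroup (T.N i)) : Set (T.N i)) →
      (∀ q : ℕ, q.Prime → q ∣ Nat.card A → q ∈ Sigma) → (T.adm i).toMonoidHom.ker ≤ χ.ker)
    (hadm : ∀ U ∈ 𝓝 (1 : ↥X.DeltaTemp), ∃ j, ((T.admKer j : Subgroup ↥X.DeltaTemp) : Set ↥X.DeltaTemp) ⊆ U) :
    ((ofSpecialFibre X d S h36 Sigma SigmaHat hsub hne hprime hp TpH HatH hle cuspMeetsH).Prop24i ∧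
      (ofSpecialFibre X d S h36 Sigma SigmaHat hsub hne hprime hp TpH HatH hle cuspMeetsH).Prop24ii ∧
      (ofSpecialFibre X d S h36 Sigma SigmaHat hsub hne hprime hp TpH HatH hle cuspMeetsH).Prop24iii) ∧
    ((ofSpecialFibre X d S h36 Sigma SigmaHat hsub hne hprime hp TpH HatH hle cuspMeetsH).Cor25Decomposition ∧
      (ofSpecialFibre X d S h36 Sigma SigmaHat hsub hne hprime hp TpH HatH hle cuspMeetsH).Cor25Inertia) := by
  classical
  -- `ι(⊤) = ⊤` for the level graphs and the level quotients (compactness)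
  have hrange : ∀ i, (⊤ : Subgroup (T.chart i).G).map (levelGraph X T Sigma SigmaHat hsub hne hprime i).ι = ⊤ :=
    levelGraph_map_top_eq_top X T Sigma SigmaHat hsub hne hprime
  have hQrange := qTower_map_top_eq_top X T Sigma SigmaHat hsub hne hprime d S h36 hp TpH HatH hle cuspMeetsH P
  -- (i)-side: the one-vertex PSC datum on `Π̂_{𝔾_{J_i}}`, `Π_v := ι(⊤)`
  let G : ∀ i, PSCDatum (levelGraph X T Sigma SigmaHat hsub hne hprime i).Hat := fun i =>
    { Sigma := {q | q.Prime}
      sigma_prime := fun _ hq => hq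
      sigma_nonempty := ⟨2, Nat.prime_two⟩
      graph := { V := PUnit, N := PEmpty, C := PEmpty, nodeEnds := fun e => e.elim, cuspEnd := fun c => c.elim }
      vertGp := fun _ => (⊤ : Subgroup (T.chart i).G).map (levelGraph X T Sigma SigmaHat hsub hne hprime i).ι
      nodeGp := fun e => e.elim
      cuspGp := fun c => c.elim
      genus := fun _ => 0
      isClosed_vertGp := fun _ => by
        rw [hrange i, Subgroup.coe_top]; exact isClosed_univ
      isClosed_nodeGp := fun e => e.elim
      isClosed_cuspGp := fun c => c.elim
      nodeGp_le := fun e => e.elim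
      cuspGp_le := fun c => c.elim
      proSigma := ⟨fun _ _ _ hq _ => hq⟩ }
  -- (A3) := F-2540 by its first disjunct
  have hNN : ∀ i, (G i).VerticialIntersectionNear := by
    intro i ε v w g h _
    refine Or.inl ⟨Subsingleton.elim _ _, ?_⟩
    change g⁻¹ * h ∈ (⊤ : Subgroup (T.chart i).G).map (levelGraph X T Sigma SigmaHat hsub hne hprime i).ι
    rw [hrange i]; exact Subgroup.mem_top _
  -- identification data
  let σ : ∀ i, (T.Gc i).graph.Vertex ≃ (G i).graph.V := fun i => @Equiv.equivPUnit _ (hUV i).some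
  let Λv : ∀ i, (G i).graph.V → Subgroup (T.chart i).G := fun _ _ => ⊤
  have hvert : ∀ i (v : (T.Gc i).graph.Vertex), Λv i (σ i v) ∈ verticialSubgroups (T.chart i) v :=
    fun i v => htop i v
  have hΛv : ∀ i v, (Λv i v).map (levelGraph X T Sigma SigmaHat hsub hne hprime i).ι = (G i).vertGp v :=
    fun _ _ => rfl
  -- (ii)-side: one-vertex decomposition data on `Π^tp_X/admKer_j`, `Π^temp_{𝔊,v} := ⊤`
  let Dd : ∀ j, DecompositionData ((qTowerOfSpecialFibreTower X T d S h36 Sigma SigmaHat hsub hne hprime hp TpH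
      HatH hle cuspMeetsH P.admKer_normal_pi).Q j).Tp Unit Empty := fun _ =>
    { E := Empty
      edgeOf := fun b => b.elim
      abut := fun b => b.elim
      vertGp := fun _ => ⊤
      brGp := fun b => b.elim
      brGp_le_vertGp := fun b => b.elim }
  have hvertD : ∀ j (W : Subgroup ((qTowerOfSpecialFibreTower X T d S h36 Sigma SigmaHat hsub hne hprime hp TpH
      HatH hle cuspMeetsH P.admKer_normal_pi).Q j).Tp), IsVerticial (Dd j) W → W = ⊤ := by
    rintro j W ⟨_, g, rfl⟩
    exact conjSubgroup_top g
  -- `hI_j`: [SemiAnbd] Thm 5.4 (i) shape — the only verticial subgroup is `⊤`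
  have hI : ∀ (j : ℕ) (a : ((qTowerOfSpecialFibreTower X T d S h36 Sigma SigmaHat hsub hne hprime hp TpH HatH hle
      cuspMeetsH P.admKer_normal_pi).Q j).Tp →* X.GK),
      a.comp ((qTowerOfSpecialFibreTower X T d S h36 Sigma SigmaHat hsub hne hprime hp TpH HatH hle cuspMeetsH
        P.admKer_normal_pi).qtp j) = X.augGK.toMonoidHom → ArithMaximalCompactStatementI (Dd j) a := by
    intro j a _ K _ _
    refine ⟨⟨⊤, ⟨(), 1, (conjSubgroup_top _).symm⟩, le_top⟩, ?_⟩
    intro W₁ W₂ hW₁ hW₂ hne12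
    exact absurd ((hvertD j W₁ hW₁).trans (hvertD j W₂ hW₂).symm) hne12
  -- `hA3ar_j` by its first disjunct (`ι_j(⊤) = ⊤`)
  refine prop24_cor25_ofPiData_byName_noRF X d T Sigma SigmaHat hsub hne hprime S h36 hp TpH HatH hle cuspMeetsH
    P x hTF G hNN σ Λv hvert hΛv (fun i e => e.elim) (fun i e => e.elim) (fun i e => e.elim) (fun i e => e.elim)
    (fun i e => e.elim) (fun i e => e.elim) (fun i e => e.elim) (fun i e => e.elim) hab hadm Dd hI
    (EA := fun _ => Empty) (fun j e => e.elim) (fun j e => e.elim) (fun j e => e.elim) (fun j e => e.elim) ?_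
  intro j Λ _ _ _ v w g h γ _ _
  refine Or.inl ⟨Subsingleton.elim _ _, ?_⟩
  change g⁻¹ * h ∈ (⊤ : Subgroup _).map _
  rw [hQrange j]; exact Subgroup.mem_top _

/-! ### D. The headline: the §2 one-call is jointly non-vacuous -/

/-- **THE §2 ONE-CALL IS JOINTLY NON-VACUOUS (binder-free headline).**  For every prime `p` there exist a
`TemperedCurve p` datum `X` with parameter bundle `d`, special-fibre data `S`, a special-fibre tower `T` with an origin
record `P : PiData X d S T`, a CUSP of `X_K`, and a nonempty prime set `Σ ∌ p` (`Σ̂ := Σ`, `ℍ := ⊤`) such that the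
CONCLUSION of the one-call `prop24_cor25_ofPiData_byName_noRF` — [IUTchI] Prop. 2.4 (i)(ii)(iii) ∧ Cor. 2.5 AS TYPED
at the genuine-shape 𝔛-datum `ofSpecialFibre X d S …` — HOLDS, obtained by CALLING it (all six laws and all data
inhabited: `prop24_cor25_ofPiData_byName_of_oneVertexFibres` at abc-iut-f-193's cusped free-profinite witness with
exposed fibres, `exists_piData_cusp_torsionFreeAb_ab_adm_exposed`).  DEGENERATE WITNESS (module docstring): one-vertex
fibres, no nodes, `Π^temp = G_{ℚ_p} × F̂₂` compact (`= Π̂`), `admKer = 1`; `hTF` genuine-shape; a model inhabits OUR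
binders only.  ([IUTchI] Prop 2.4, Cor 2.5 pp.50-51) [claim: Mochizuki2012, status: disputed] -/
theorem sec2_oneCall_nonvacuous (p : ℕ) [Fact p.Prime] :
    ∃ (X : TemperedCurve p) (d : X.GroupLevelData) (S : SpecialFibreData (X.toTemperedArithmeticGroup d))
      (T : SpecialFibreTower X.DeltaTemp) (_ : SpecialFibreTower.PiData X d S T) (_ : {x : X.Pt // X.IsCusp x})
      (Sigma : Set ℕ) (hne : Sigma.Nonempty) (hprime : ∀ q ∈ Sigma, q.Prime) (hp : p ∉ Sigma),
      ((ofSpecialFibre X d S S.hyp.toProp36Hypotheses Sigma Sigma Set.Subset.rfl hne hprime hp ⊤ ⊤ le_top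
            (fun _ => True)).Prop24i ∧
        (ofSpecialFibre X d S S.hyp.toProp36Hypotheses Sigma Sigma Set.Subset.rfl hne hprime hp ⊤ ⊤ le_top
            (fun _ => True)).Prop24ii ∧
        (ofSpecialFibre X d S S.hyp.toProp36Hypotheses Sigma Sigma Set.Subset.rfl hne hprime hp ⊤ ⊤ le_top
            (fun _ => True)).Prop24iii) ∧
      ((ofSpecialFibre X d S S.hyp.toProp36Hypotheses Sigma Sigma Set.Subset.rfl hne hprime hp ⊤ ⊤ le_top
            (fun _ => True)).Cor25Decomposition ∧
        (ofSpecialFibre X d S S.hyp.toProp36Hypotheses Sigma Sigma Set.Subset.rfl hne hprime hp ⊤ ⊤ le_top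
            (fun _ => True)).Cor25Inertia) := by
  obtain ⟨X, d, S, T, ⟨P⟩, -, -, ⟨x⟩, -, hTF, hab, hadm, hcpt, hUV, -, -, htop, -⟩ :=
    exists_piData_cusp_torsionFreeAb_ab_adm_exposed p
  haveI := hcpt
  -- a prime `q ≠ p`: `Σ := {q}`
  let q : ℕ := if p = 2 then 3 else 2
  have hq : q.Prime := by
    by_cases h : p = 2
    · simp only [q, h, if_true]; exact Nat.prime_three
    · simp only [q, h, if_false]; exact Nat.prime_two
  have hpq : p ≠ q := by
    by_cases h : p = 2
    · simp only [q, h, if_true]; decide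
    · simp only [q, h, if_false]; exact h
  refine ⟨X, d, S, T, P, x, {q}, Set.singleton_nonempty q, fun r hr => ?_, fun h => hpq (Set.mem_singleton_iff.mp h),
    prop24_cor25_ofPiData_byName_of_oneVertexFibres X T {q} {q} Set.Subset.rfl (Set.singleton_nonempty q) _ d S
      S.hyp.toProp36Hypotheses _ ⊤ ⊤ le_top (fun _ => True) P x hUV htop hTF (hab {q}) hadm⟩
  rw [Set.mem_singleton_iff.mp hr]; exact hq

end OfSpecialFibre

end StableCurveTemperedData

end Literature.IUT.HodgeTheaters

end
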